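import Literature.NumberTheory.GaloisCohomology.PoitouTateRestrictedShaNaturalAtOfExtRoadKit
import Literature.NumberTheory.GaloisCohomology.ArchimedeanHOneVanishingTotallyComplex
import Literature.NumberTheory.GaloisRepresentations.IdeleTruncatedSUnitsSequenceExact
import Literature.NumberTheory.GaloisRepresentations.IdeleClassBarSInvariant
import HarnessLib

/-!
# `poitouTate_shaRestricted_tateDual_natural_at K ↑S'` for `K` totally complex, with the `Ext`-road kit fed by the
# TREE's `S`-idèle class formation `0 → Ē_S → I_S → C̄_S → 0` (Harari (17.1)) and its invariant map `inv_S`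

Theorems only (no definition, no named fact, no `sorry`, no instance, no notation).  Topic
`NumberTheory/GaloisCohomology`; namespace `Literature.NumberTheory.GaloisCohomology.ShaExtRoadKit`.  Lane
«PT-Ш-S-TC» of cell `bsd-eis` (crux `GoodLatticeBDPValue`), brick D5c — INTEGRATION STEP toward the lane's closer
`forall_poitouTate_shaRestricted_tateDual_natural_at_of_isTotallyComplex` (LEAD RULING #9):
`ShaExtRoadKit.natural_at_of_kit` (the assembly) instantiated with

* the class-formation short exact sequence `IdeleClassBar.truncSeqS K S' = (Ē_S → I_S → C̄_S)` in `C_{G_S}`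
  (`sUnitsToTruncD`, `truncToClassBarSD`, `truncSeqS_shortExact`; bsd-eis -w6 g11 / -w3 g17) — its `X₁` is
  `ofContinuousRep (SUnits.sUnitsRestricted K ↑S')` on the nose, as the kit requires;
* the invariant map `IdeleClassBar.invS S' : Ext²(ℤ, C̄_S) → ℚ/ℤ` (bsd-eis -w5 g10);
* the archimedean hypothesis discharged (`harch_of_isTotallyComplex`).

What remains displayed (per admissible module): Tate duality `α¹` for `(G_S, C̄_S, inv_S)` at
`A = ⟨(M^D(n))^{N_S}⟩` (`hα`; bsd-eis -w8 g13's `IdeleClassBar.tateDuality_classBarSD … |>.2.1`), the local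
invariant families with perfectness, the readouts `R_v : Ext¹(A, I_S) → H¹(K_v, M)` with (R3)/(R4) (D4b), and
`Ψ(E) = Ш²_S` (`hΨsha`, `hΨsurj`; -w7 g12's local criterion), plus the finite set of places `Σ` with
`Σ ⊇ Ω_∞`, `Σ_f = S'`.

HONEST FRAMING: a reduction; no case of Poitou–Tate duality or BSD is proved here.  AI formalisation,
established only by the kernel check.

## References
* D. Harari, *Galois Cohomology and Class Field Theory* (2020), §17.4 (17.1), Thm. 17.13 (b), Thm. 17.18, §17.5.
  [Harari2020]
* J. S. Milne, *Arithmetic Duality Theorems*, 2nd ed. (2006), I Thm. 4.10 (a) (p. 57), its proof (p. 58), §4 p. 65.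
  [MilneADT2006]
-/

noncomputable section

open CategoryTheory CategoryTheory.Abelian NumberField IsDedekindDomain Function
open scoped NumberField ContRepresentation

namespace Literature.NumberTheory.GaloisCohomology

namespace ShaExtRoadKit

open Literature.Algebra.Homology Literature.Algebra.Homology.DiscreteRep Literature.Algebra.Homology.ExtDuality
open Literature.NumberTheory.GaloisRepresentations
open Literature.NumberTheory.GaloisRepresentations.DiscreteGaloisModule
open Literature.AnabelianGeometry.AbsoluteAnabelian.Prop121vii (zmodToQmodZ)

variable {K : Type} [Field K] [NumberField K]

set_option maxRecDepth 16384 in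
-- (as for `natural_at_of_kit`: the composed objects exceed the default recursion depth)
/-- **`poitouTate_shaRestricted_tateDual_natural_at K ↑S'` for `K` totally complex, kit fed by the tree's `S`-idèle
class formation and `inv_S`.** [cite: MilneADT2006, I Thm. 4.10 (a) (p. 57), its proof (p. 58) and §4 p. 65]
[cite: Harari2020, §17.4 (17.1), Thm. 17.13 (b), §17.5] -/
theorem natural_at_of_idele_class_formation [IsTotallyComplex K] (S' : Finset (HeightOneSpectrum (𝓞 K)))
    (Sig : Finset (Place K)) (hSig₁ : ∀ w : InfinitePlace K, (Sum.inl w : Place K) ∈ Sig)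
    (hSig₂ : ∀ v : HeightOneSpectrum (𝓞 K), (Sum.inr v : Place K) ∈ Sig ↔ v ∈ (↑S' : Set (HeightOneSpectrum (𝓞 K))))
    (linv : ∀ n : ℕ, LocalInvariants K n) (hperf : ∀ (n : ℕ) [NeZero n], (linv n).IsPerfect)
    (R : ∀ (n : ℕ) (M : Type) [AddCommGroup M] [TopologicalSpace M] [DiscreteTopology M] [Finite M]
      (ρ : DiscreteGaloisModule K M) (v : Place K),
      Ext (ofContinuousRep ((ρ.tateDual n).quotientInvariants
        (ramificationSubgroup K (↑S' : Set (HeightOneSpectrum (𝓞 K)))))) (IdeleClassBar.truncIdeleBarD K S') 1 →+ galoisCohomology (ρ.toLocal v) 1)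
    (hα : ∀ (n : ℕ) [NeZero n] (M : Type) [AddCommGroup M] [TopologicalSpace M] [DiscreteTopology M]
      [Finite M] (ρ : DiscreteGaloisModule K M), (∀ m : M, n • m = 0) →
      GaloisRep.IsUnramifiedOutside (↑S' : Set (HeightOneSpectrum (𝓞 K))) ρ →
      (∀ v : HeightOneSpectrum (𝓞 K), ((Nat.card M : ℕ) : 𝓞 K) ∈ v.asIdeal → v ∈ (↑S' : Set (HeightOneSpectrum (𝓞 K)))) →
      Bijective (ExtDuality.adjointMap (P := triv (Γ := GaloisGroupUnramifiedOutside K (↑S' : Set (HeightOneSpectrum (𝓞 K)))) ℤ)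
        (IdeleClassBar.invS S') (ofContinuousRep ((ρ.tateDual n).quotientInvariants
        (ramificationSubgroup K (↑S' : Set (HeightOneSpectrum (𝓞 K)))))) (rfl : 1 + 1 = 2)))
    (hR3 : ∀ (n : ℕ) [NeZero n] (M : Type) [AddCommGroup M] [TopologicalSpace M] [DiscreteTopology M]
      [Finite M] (ρ : DiscreteGaloisModule K M), (∀ m : M, n • m = 0) →
      GaloisRep.IsUnramifiedOutside (↑S' : Set (HeightOneSpectrum (𝓞 K))) ρ →
      (∀ v : HeightOneSpectrum (𝓞 K), ((Nat.card M : ℕ) : 𝓞 K) ∈ v.asIdeal → v ∈ (↑S' : Set (HeightOneSpectrum (𝓞 K)))) →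
      ∀ t : Π v : Place K, galoisCohomology (ρ.toLocal v) 1,
        ∃ e : Ext (ofContinuousRep ((ρ.tateDual n).quotientInvariants
        (ramificationSubgroup K (↑S' : Set (HeightOneSpectrum (𝓞 K)))))) (IdeleClassBar.truncIdeleBarD K S') 1, ∀ v ∈ Sig, R n M ρ v e = t v)
    (hR4 : ∀ (n : ℕ) [NeZero n] (M : Type) [AddCommGroup M] [TopologicalSpace M] [DiscreteTopology M]
      [Finite M] (ρ : DiscreteGaloisModule K M), (∀ m : M, n • m = 0) →
      GaloisRep.IsUnramifiedOutside (↑S' : Set (HeightOneSpectrum (𝓞 K))) ρ →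
      (∀ v : HeightOneSpectrum (𝓞 K), ((Nat.card M : ℕ) : 𝓞 K) ∈ v.asIdeal → v ∈ (↑S' : Set (HeightOneSpectrum (𝓞 K)))) →
      ∀ (e : Ext (ofContinuousRep ((ρ.tateDual n).quotientInvariants
        (ramificationSubgroup K (↑S' : Set (HeightOneSpectrum (𝓞 K)))))) (IdeleClassBar.truncIdeleBarD K S') 1)
        (y : restrictedCohomology (ρ.tateDual n) (↑S' : Set (HeightOneSpectrum (𝓞 K))) 1),
        ShaExtRoad.read ρ (↑S' : Set (HeightOneSpectrum (𝓞 K))) (T := IdeleClassBar.truncSeqS K S') (ofContinuousRep ((ρ.tateDual n).quotientInvariants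
        (ramificationSubgroup K (↑S' : Set (HeightOneSpectrum (𝓞 K)))))) (triv ℤ) (IdeleClassBar.invS S')
            (natS (↑S' : Set (HeightOneSpectrum (𝓞 K))) ρ n) (ShaExtRoad.idelePart (T := IdeleClassBar.truncSeqS K S') (ofContinuousRep ((ρ.tateDual n).quotientInvariants
        (ramificationSubgroup K (↑S' : Set (HeightOneSpectrum (𝓞 K)))))) e) y =
          zmodToQmodZ n (∑ v ∈ Sig, localTatePairingZMod ρ n v (linv n v) (R n M ρ v e)
            (restrictedLocalization (ρ.tateDual n) (↑S' : Set (HeightOneSpectrum (𝓞 K))) v 1 y)))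
    (hΨsha : ∀ (n : ℕ) [NeZero n] (M : Type) [AddCommGroup M] [TopologicalSpace M] [DiscreteTopology M]
      [Finite M] [Finite (TateDual K M n)] [NeZero (Nat.card M)] (ρ : DiscreteGaloisModule K M)
      (hn : ∀ m : M, n • m = 0) (hur : GaloisRep.IsUnramifiedOutside (↑S' : Set (HeightOneSpectrum (𝓞 K))) ρ)
      (hS : ∀ v : HeightOneSpectrum (𝓞 K), ((Nat.card M : ℕ) : 𝓞 K) ∈ v.asIdeal → v ∈ (↑S' : Set (HeightOneSpectrum (𝓞 K)))),
      ∀ x : Ext (ofContinuousRep ((ρ.tateDual n).quotientInvariants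
        (ramificationSubgroup K (↑S' : Set (HeightOneSpectrum (𝓞 K)))))) (IdeleClassBar.classBarSD K S') 1,
        ShaExtRoad.obstruction ρ (↑S' : Set (HeightOneSpectrum (𝓞 K))) (IdeleClassBar.truncSeqS_shortExact (K := K) (S := S')) (ofContinuousRep ((ρ.tateDual n).quotientInvariants
        (ramificationSubgroup K (↑S' : Set (HeightOneSpectrum (𝓞 K))))))
          (RestrictedExtCmp.cmp (↑S' : Set (HeightOneSpectrum (𝓞 K))) ρ n (Nat.card M)
            (fun _ => card_nsmul_eq_zero') hS hn ((isUnramifiedOutside_iff_ramificationSubgroup_le_ker ρ _).1 hur) 2) x ∈ shaRestricted ρ (↑S' : Set (HeightOneSpectrum (𝓞 K))) 2)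
    (hΨsurj : ∀ (n : ℕ) [NeZero n] (M : Type) [AddCommGroup M] [TopologicalSpace M] [DiscreteTopology M]
      [Finite M] [Finite (TateDual K M n)] [NeZero (Nat.card M)] (ρ : DiscreteGaloisModule K M)
      (hn : ∀ m : M, n • m = 0) (hur : GaloisRep.IsUnramifiedOutside (↑S' : Set (HeightOneSpectrum (𝓞 K))) ρ)
      (hS : ∀ v : HeightOneSpectrum (𝓞 K), ((Nat.card M : ℕ) : 𝓞 K) ∈ v.asIdeal → v ∈ (↑S' : Set (HeightOneSpectrum (𝓞 K)))),
      ∀ c ∈ shaRestricted ρ (↑S' : Set (HeightOneSpectrum (𝓞 K))) 2, ∃ x : Ext (ofContinuousRep ((ρ.tateDual n).quotientInvariants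
        (ramificationSubgroup K (↑S' : Set (HeightOneSpectrum (𝓞 K)))))) (IdeleClassBar.classBarSD K S') 1,
        ShaExtRoad.obstruction ρ (↑S' : Set (HeightOneSpectrum (𝓞 K))) (IdeleClassBar.truncSeqS_shortExact (K := K) (S := S')) (ofContinuousRep ((ρ.tateDual n).quotientInvariants
        (ramificationSubgroup K (↑S' : Set (HeightOneSpectrum (𝓞 K))))))
          (RestrictedExtCmp.cmp (↑S' : Set (HeightOneSpectrum (𝓞 K))) ρ n (Nat.card M)
            (fun _ => card_nsmul_eq_zero') hS hn ((isUnramifiedOutside_iff_ramificationSubgroup_le_ker ρ _).1 hur) 2) x = c) :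
    poitouTate_shaRestricted_tateDual_natural_at K (↑S' : Set (HeightOneSpectrum (𝓞 K))) :=
  natural_at_of_kit (↑S' : Set (HeightOneSpectrum (𝓞 K))) S'.finite_toSet (IdeleClassBar.sUnitsToTruncD K S') (IdeleClassBar.truncToClassBarSD K S')
    (IdeleClassBar.sUnitsToTruncD_comp_truncToClassBarSD (K := K) (S := S'))
    (IdeleClassBar.truncSeqS_shortExact (K := K) (S := S')) (IdeleClassBar.invS S') Sig hSig₁ hSig₂ linv hperf
    (fun n _ _ _ _ _ _ ρ w Φ => harch_of_isTotallyComplex ρ n (linv n) w Φ) R hα hR3 hR4 hΨsha hΨsurj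

set_option maxRecDepth 16384 in
-- (as for `natural_at_of_kit`: the composed objects exceed the default recursion depth)
/-- **The same with the bridge `nat` DISPLAYED** (`natural_at_of_kit'`): for a layer description of
`H¹(G_S, M^D(n)) ≅ Ext¹(ℤ, A)` on which (R4) is provable (bsd-eis -w5 g11). [cite: MilneADT2006, I Thm. 4.10 (a) (p. 57), its proof (p. 58) and §4 p. 65]
[cite: Harari2020, §17.4 (17.1), Thm. 17.13 (b), §17.5] -/
theorem natural_at_of_idele_class_formation' [IsTotallyComplex K] (S' : Finset (HeightOneSpectrum (𝓞 K)))
    (Sig : Finset (Place K)) (hSig₁ : ∀ w : InfinitePlace K, (Sum.inl w : Place K) ∈ Sig)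
    (hSig₂ : ∀ v : HeightOneSpectrum (𝓞 K), (Sum.inr v : Place K) ∈ Sig ↔ v ∈ (↑S' : Set (HeightOneSpectrum (𝓞 K))))
    (linv : ∀ n : ℕ, LocalInvariants K n) (hperf : ∀ (n : ℕ) [NeZero n], (linv n).IsPerfect)
    (R : ∀ (n : ℕ) (M : Type) [AddCommGroup M] [TopologicalSpace M] [DiscreteTopology M] [Finite M]
      (ρ : DiscreteGaloisModule K M) (v : Place K),
      Ext (ofContinuousRep ((ρ.tateDual n).quotientInvariants
        (ramificationSubgroup K (↑S' : Set (HeightOneSpectrum (𝓞 K)))))) (IdeleClassBar.truncIdeleBarD K S') 1 →+ galoisCohomology (ρ.toLocal v) 1)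
    (nat : ∀ (n : ℕ) (M : Type) [AddCommGroup M] [TopologicalSpace M] [DiscreteTopology M] [Finite M]
      (ρ : DiscreteGaloisModule K M), restrictedCohomology (ρ.tateDual n) (↑S' : Set (HeightOneSpectrum (𝓞 K))) 1 →+
        Ext (triv (Γ := GaloisGroupUnramifiedOutside K (↑S' : Set (HeightOneSpectrum (𝓞 K)))) ℤ) (ofContinuousRep ((ρ.tateDual n).quotientInvariants
        (ramificationSubgroup K (↑S' : Set (HeightOneSpectrum (𝓞 K)))))) 1)
    (hnat : ∀ (n : ℕ) (M : Type) [AddCommGroup M] [TopologicalSpace M] [DiscreteTopology M] [Finite M]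
      (ρ : DiscreteGaloisModule K M), Bijective (nat n M ρ))
    (hnatG : ∀ (n n' : ℕ) (M M' : Type) [AddCommGroup M] [TopologicalSpace M] [DiscreteTopology M] [Finite M]
      [AddCommGroup M'] [TopologicalSpace M'] [DiscreteTopology M'] [Finite M']
      (ρ : DiscreteGaloisModule K M) (ρ' : DiscreteGaloisModule K M')
      (G : (ρ'.tateDual n').toTopRep ⟶ (ρ.tateDual n).toTopRep) (c : restrictedCohomology (ρ'.tateDual n') (↑S' : Set (HeightOneSpectrum (𝓞 K))) 1),
      nat n M ρ ((ContinuousCohomology.map (ContinuousMonoidHom.id (GaloisGroupUnramifiedOutside K (↑S' : Set (HeightOneSpectrum (𝓞 K)))))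
        (ContinuousRep.invariantsHom (N := ramificationSubgroup K (↑S' : Set (HeightOneSpectrum (𝓞 K)))) G) 1).hom c) =
        (nat n' M' ρ' c).comp
          (Ext.mk₀ (RestrictedExtTriv.quotientInvariantsMap (ρ'.tateDual n') (ρ.tateDual n) (↑S' : Set (HeightOneSpectrum (𝓞 K))) G)) (add_zero 1))
    (hα : ∀ (n : ℕ) [NeZero n] (M : Type) [AddCommGroup M] [TopologicalSpace M] [DiscreteTopology M]
      [Finite M] (ρ : DiscreteGaloisModule K M), (∀ m : M, n • m = 0) →
      GaloisRep.IsUnramifiedOutside (↑S' : Set (HeightOneSpectrum (𝓞 K))) ρ →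
      (∀ v : HeightOneSpectrum (𝓞 K), ((Nat.card M : ℕ) : 𝓞 K) ∈ v.asIdeal → v ∈ (↑S' : Set (HeightOneSpectrum (𝓞 K)))) →
      Bijective (ExtDuality.adjointMap (P := triv (Γ := GaloisGroupUnramifiedOutside K (↑S' : Set (HeightOneSpectrum (𝓞 K)))) ℤ)
        (IdeleClassBar.invS S') (ofContinuousRep ((ρ.tateDual n).quotientInvariants
        (ramificationSubgroup K (↑S' : Set (HeightOneSpectrum (𝓞 K)))))) (rfl : 1 + 1 = 2)))
    (hR3 : ∀ (n : ℕ) [NeZero n] (M : Type) [AddCommGroup M] [TopologicalSpace M] [DiscreteTopology M]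
      [Finite M] (ρ : DiscreteGaloisModule K M), (∀ m : M, n • m = 0) →
      GaloisRep.IsUnramifiedOutside (↑S' : Set (HeightOneSpectrum (𝓞 K))) ρ →
      (∀ v : HeightOneSpectrum (𝓞 K), ((Nat.card M : ℕ) : 𝓞 K) ∈ v.asIdeal → v ∈ (↑S' : Set (HeightOneSpectrum (𝓞 K)))) →
      ∀ t : Π v : Place K, galoisCohomology (ρ.toLocal v) 1,
        ∃ e : Ext (ofContinuousRep ((ρ.tateDual n).quotientInvariants
        (ramificationSubgroup K (↑S' : Set (HeightOneSpectrum (𝓞 K)))))) (IdeleClassBar.truncIdeleBarD K S') 1, ∀ v ∈ Sig, R n M ρ v e = t v)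
    (hR4 : ∀ (n : ℕ) [NeZero n] (M : Type) [AddCommGroup M] [TopologicalSpace M] [DiscreteTopology M]
      [Finite M] (ρ : DiscreteGaloisModule K M), (∀ m : M, n • m = 0) →
      GaloisRep.IsUnramifiedOutside (↑S' : Set (HeightOneSpectrum (𝓞 K))) ρ →
      (∀ v : HeightOneSpectrum (𝓞 K), ((Nat.card M : ℕ) : 𝓞 K) ∈ v.asIdeal → v ∈ (↑S' : Set (HeightOneSpectrum (𝓞 K)))) →
      ∀ (e : Ext (ofContinuousRep ((ρ.tateDual n).quotientInvariants
        (ramificationSubgroup K (↑S' : Set (HeightOneSpectrum (𝓞 K)))))) (IdeleClassBar.truncIdeleBarD K S') 1)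
        (y : restrictedCohomology (ρ.tateDual n) (↑S' : Set (HeightOneSpectrum (𝓞 K))) 1),
        ShaExtRoad.read ρ (↑S' : Set (HeightOneSpectrum (𝓞 K))) (T := IdeleClassBar.truncSeqS K S') (ofContinuousRep ((ρ.tateDual n).quotientInvariants
        (ramificationSubgroup K (↑S' : Set (HeightOneSpectrum (𝓞 K)))))) (triv ℤ) (IdeleClassBar.invS S')
            (nat n M ρ) (ShaExtRoad.idelePart (T := IdeleClassBar.truncSeqS K S') (ofContinuousRep ((ρ.tateDual n).quotientInvariants
        (ramificationSubgroup K (↑S' : Set (HeightOneSpectrum (𝓞 K)))))) e) y =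
          zmodToQmodZ n (∑ v ∈ Sig, localTatePairingZMod ρ n v (linv n v) (R n M ρ v e)
            (restrictedLocalization (ρ.tateDual n) (↑S' : Set (HeightOneSpectrum (𝓞 K))) v 1 y)))
    (hΨsha : ∀ (n : ℕ) [NeZero n] (M : Type) [AddCommGroup M] [TopologicalSpace M] [DiscreteTopology M]
      [Finite M] [Finite (TateDual K M n)] [NeZero (Nat.card M)] (ρ : DiscreteGaloisModule K M)
      (hn : ∀ m : M, n • m = 0) (hur : GaloisRep.IsUnramifiedOutside (↑S' : Set (HeightOneSpectrum (𝓞 K))) ρ)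
      (hS : ∀ v : HeightOneSpectrum (𝓞 K), ((Nat.card M : ℕ) : 𝓞 K) ∈ v.asIdeal → v ∈ (↑S' : Set (HeightOneSpectrum (𝓞 K)))),
      ∀ x : Ext (ofContinuousRep ((ρ.tateDual n).quotientInvariants
        (ramificationSubgroup K (↑S' : Set (HeightOneSpectrum (𝓞 K)))))) (IdeleClassBar.classBarSD K S') 1,
        ShaExtRoad.obstruction ρ (↑S' : Set (HeightOneSpectrum (𝓞 K))) (IdeleClassBar.truncSeqS_shortExact (K := K) (S := S')) (ofContinuousRep ((ρ.tateDual n).quotientInvariants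
        (ramificationSubgroup K (↑S' : Set (HeightOneSpectrum (𝓞 K))))))
          (RestrictedExtCmp.cmp (↑S' : Set (HeightOneSpectrum (𝓞 K))) ρ n (Nat.card M)
            (fun _ => card_nsmul_eq_zero') hS hn ((isUnramifiedOutside_iff_ramificationSubgroup_le_ker ρ _).1 hur) 2) x ∈ shaRestricted ρ (↑S' : Set (HeightOneSpectrum (𝓞 K))) 2)
    (hΨsurj : ∀ (n : ℕ) [NeZero n] (M : Type) [AddCommGroup M] [TopologicalSpace M] [DiscreteTopology M]
      [Finite M] [Finite (TateDual K M n)] [NeZero (Nat.card M)] (ρ : DiscreteGaloisModule K M)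
      (hn : ∀ m : M, n • m = 0) (hur : GaloisRep.IsUnramifiedOutside (↑S' : Set (HeightOneSpectrum (𝓞 K))) ρ)
      (hS : ∀ v : HeightOneSpectrum (𝓞 K), ((Nat.card M : ℕ) : 𝓞 K) ∈ v.asIdeal → v ∈ (↑S' : Set (HeightOneSpectrum (𝓞 K)))),
      ∀ c ∈ shaRestricted ρ (↑S' : Set (HeightOneSpectrum (𝓞 K))) 2, ∃ x : Ext (ofContinuousRep ((ρ.tateDual n).quotientInvariants
        (ramificationSubgroup K (↑S' : Set (HeightOneSpectrum (𝓞 K)))))) (IdeleClassBar.classBarSD K S') 1,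
        ShaExtRoad.obstruction ρ (↑S' : Set (HeightOneSpectrum (𝓞 K))) (IdeleClassBar.truncSeqS_shortExact (K := K) (S := S')) (ofContinuousRep ((ρ.tateDual n).quotientInvariants
        (ramificationSubgroup K (↑S' : Set (HeightOneSpectrum (𝓞 K))))))
          (RestrictedExtCmp.cmp (↑S' : Set (HeightOneSpectrum (𝓞 K))) ρ n (Nat.card M)
            (fun _ => card_nsmul_eq_zero') hS hn ((isUnramifiedOutside_iff_ramificationSubgroup_le_ker ρ _).1 hur) 2) x = c) :
    poitouTate_shaRestricted_tateDual_natural_at K (↑S' : Set (HeightOneSpectrum (𝓞 K))) :=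
  natural_at_of_kit' (↑S' : Set (HeightOneSpectrum (𝓞 K))) S'.finite_toSet (IdeleClassBar.sUnitsToTruncD K S') (IdeleClassBar.truncToClassBarSD K S')
    (IdeleClassBar.sUnitsToTruncD_comp_truncToClassBarSD (K := K) (S := S'))
    (IdeleClassBar.truncSeqS_shortExact (K := K) (S := S')) (IdeleClassBar.invS S') Sig hSig₁ hSig₂ linv hperf
    (fun n _ _ _ _ _ _ ρ w Φ => harch_of_isTotallyComplex ρ n (linv n) w Φ) R nat hnat hnatG hα hR3 hR4 hΨsha
    hΨsurj

end ShaExtRoadKit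

end Literature.NumberTheory.GaloisCohomology

end
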